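import Summits.QuantumAdvantage.QuantumAdvantage.Theorems.CharDialBlockDialE
import HarnessLib

/-!
# The mask dial, part A: MASKED separated windows, the piece map, the walk bookkeeping and ★ `maskPiece_hard` (decomp-qadv lens-6 g18 «NullDial» REV2, tree part 31C)

THE FREEZE-ALL-FORMS CEILING, first half.  A re-set move `0^Z ↔ 1^Z` of a SET `Z` of coordinates freezes every cut's presented form iff `Z` is a
COMMON ZERO-SUM SET of the coefficient matrix, and moves the weight by `|Z| (mod 3)`.  The block dial (tree parts 30M–30Q) is `Z` = a constant
`p`-block, the null dial (parts 31A/31B) is `Z` = a window of length `ℓ ≢ 0 (mod 3)`.  Here `Z` is ARBITRARY inside separated SPAN WINDOWS: the data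
are separated spans `[s k, s k + ℓ)` (exactly the hypothesis of 30M) and a MASK `Z ⊆ {0,…,n−1}`; block `k`'s set is `zblk k = [s k, s k + ℓ) ∩ Z`,
all of the same size `m ≢ 0 (mod 3)`; the piece map `zset u v` puts the constant bit `v k` on `zblk k` and keeps `u` elsewhere (also on the unmasked
coordinates inside the spans).  Everything span-based is cited BY NAME from 30M/30N (`blk`, `inBlk_unique`, `qcut`, `before_iff`, `strad`,
`card_strad_le_one`, `sel`, `sel_congr`, `card_blkMeet_le`, `mod3_of_one/two`, `rfac`, `hasDeg_of_dependsOn_blk`, `bellEquiv`); new here: the masked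
bookkeeping (`wt_zset`, `wtPrefix_zset`, `walkExp_zset` with factor `m`), liveness (`live_iff_z`), the frozen-form lemmas for zero-sum masked blocks,
the game identity `ringWinU_zset_gen` and ★ `maskPiece_hard` (constants uniform in `ℓ, m, p`; no primality).
Supports item stmt-QuantumAdvantage-32604 (`CharDial.WalkHardFJLinOdd`); source: pub annex g18/OrbitDial38.lean REV2 (sha256 7aeccba348e162ea…) §38e, namespace `…Theses.OrbitDial.MaskDial`,
statements and proofs verbatim (Prop-free).
-/

set_option autoImplicit false

namespace Summit.QuantumAdvantage.AdviceFreeQNC0.JLinPeel.MaskDial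

open Finset
open Summit.QuantumAdvantage.AdviceFreeQNC0
open Summit.QuantumAdvantage.AdviceFreeQNC0.JLinPeel.BlockDial
open Literature.Computability.MetaComplexity Literature.Computability.MetaComplexity.Smolensky

section MaskPiece
variable {n N : ℕ}

/-- the MASKED `k`-th block: the coordinates of the span window `[s k, s k + ℓ)` lying in the mask `Z`. -/
def zblk (ℓ : ℕ) (s : Fin N → ℕ) (Z : Finset (Fin n)) (k : Fin N) : Finset (Fin n) := (blk ℓ s k).filter fun i => i ∈ Z

/-- the union of the masked blocks. -/
def zblkU (ℓ : ℕ) (s : Fin N → ℕ) (Z : Finset (Fin n)) : Finset (Fin n) := univ.biUnion (zblk ℓ s Z)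

variable {ℓ m p : ℕ} {s : Fin N → ℕ} {Z : Finset (Fin n)}

/-- membership in a masked block. -/
theorem mem_zblk {k : Fin N} {i : Fin n} : i ∈ zblk ℓ s Z k ↔ (s k ≤ i.val ∧ i.val < s k + ℓ) ∧ i ∈ Z := by
  simp [zblk, mem_blk]

/-- membership in the union of the masked blocks. -/
theorem mem_zblkU {i : Fin n} : i ∈ zblkU ℓ s Z ↔ ∃ k, (s k ≤ i.val ∧ i.val < s k + ℓ) ∧ i ∈ Z := by
  simp [zblkU, mem_zblk]

/-- a masked block lies inside its span window. -/
theorem zblk_subset_blk (k : Fin N) : zblk ℓ s Z k ⊆ blk ℓ s k := Finset.filter_subset _ _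

/-- the MASKED PIECE through `u`: the masked block `k` carries the constant bit `v k`, every other coordinate keeps `u`. -/
noncomputable def zset (ℓ : ℕ) (s : Fin N → ℕ) (Z : Finset (Fin n)) (u : Fin n → Bool) (v : Fin N → Bool) : Fin n → Bool := fun i =>
  if h : (∃ k, (s k ≤ i.val ∧ i.val < s k + ℓ)) ∧ i ∈ Z then v h.1.choose else u i

/-- inside the masked block `k` the piece point reads `v k`. -/
theorem zset_of_in (h : ((∀ k k', k < k' → s k + ℓ ≤ s k') ∧ (∀ k, s k + ℓ ≤ n))) (u : Fin n → Bool) (v : Fin N → Bool) {k : Fin N} {i : Fin n}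
    (hk : (s k ≤ i.val ∧ i.val < s k + ℓ)) (hZ : i ∈ Z) : zset ℓ s Z u v i = v k := by
  unfold zset
  have hex : (∃ k, (s k ≤ i.val ∧ i.val < s k + ℓ)) ∧ i ∈ Z := ⟨⟨k, hk⟩, hZ⟩
  rw [dif_pos hex, inBlk_unique h hex.1.choose_spec hk]

/-- off the masked blocks the piece point reads `u`. -/
theorem zset_of_out (u : Fin n → Bool) (v : Fin N → Bool) {i : Fin n} (hi : ∀ k, ¬ ((s k ≤ i.val ∧ i.val < s k + ℓ) ∧ i ∈ Z)) :
    zset ℓ s Z u v i = u i := by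
  unfold zset
  rw [dif_neg]
  rintro ⟨⟨k, hk⟩, hZ⟩
  exact hi k ⟨hk, hZ⟩

/-- off the union no masked block contains the coordinate. -/
theorem not_in_of_mem_sdiff {i : Fin n} (hi : i ∈ univ \ zblkU ℓ s Z) : ∀ k, ¬ ((s k ≤ i.val ∧ i.val < s k + ℓ) ∧ i ∈ Z) := by
  rw [mem_sdiff, mem_zblkU, not_exists] at hi
  exact hi.2

/-- the masked blocks are pairwise disjoint. -/
theorem zblk_disjoint (h : ((∀ k k', k < k' → s k + ℓ ≤ s k') ∧ (∀ k, s k + ℓ ≤ n))) :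
    Set.PairwiseDisjoint (↑(univ : Finset (Fin N))) (zblk ℓ s Z) := by
  intro k _ k' _ hne
  exact Finset.disjoint_left.mpr fun i hi hi' => hne (inBlk_unique h (mem_zblk.mp hi).1 (mem_zblk.mp hi').1)

/-- a sum over all coordinates = the off-mask part + the masked block parts. -/
theorem sum_split_z (h : ((∀ k k', k < k' → s k + ℓ ≤ s k') ∧ (∀ k, s k + ℓ ≤ n))) {A : Type*} [AddCommMonoid A] (f : Fin n → A) :
    ∑ i, f i = (∑ i ∈ univ \ zblkU ℓ s Z, f i) + ∑ k : Fin N, ∑ i ∈ zblk ℓ s Z k, f i := by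
  rw [← Finset.sum_biUnion (zblk_disjoint h)]
  exact (Finset.sum_sdiff (subset_univ _)).symm

/-- off-mask weight of `u`. -/
def zoffW (ℓ : ℕ) (s : Fin N → ℕ) (Z : Finset (Fin n)) (u : Fin n → Bool) : ℕ := ((univ \ zblkU ℓ s Z).filter fun i => u i = true).card

/-- off-mask prefix weight of `u` at cut `g`. -/
def zoffP (ℓ : ℕ) (s : Fin N → ℕ) (Z : Finset (Fin n)) (u : Fin n → Bool) (g : ℕ) : ℕ :=
  ((univ \ zblkU ℓ s Z).filter fun i => i.val < g ∧ u i = true).card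

/-- how much of the masked block `k` lies before cut `g`. -/
def zmcut (ℓ : ℕ) (s : Fin N → ℕ) (Z : Finset (Fin n)) (k : Fin N) (g : ℕ) : ℕ := ((zblk ℓ s Z k).filter fun i => i.val < g).card

/-- **weight on a masked piece**: `wt (zset u v) = zoffW u + m·wt v` (all masked blocks of size `m`). -/
theorem wt_zset (h : ((∀ k k', k < k' → s k + ℓ ≤ s k') ∧ (∀ k, s k + ℓ ≤ n))) (hm : ∀ k, (zblk ℓ s Z k).card = m)
    (u : Fin n → Bool) (v : Fin N → Bool) :
    wt (zset ℓ s Z u v) = zoffW ℓ s Z u + m * wt v := by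
  unfold wt zoffW
  rw [Finset.card_filter, sum_split_z h, Finset.card_filter, Finset.card_filter, Finset.mul_sum]
  congr 1
  · refine Finset.sum_congr rfl fun i hi => ?_
    rw [zset_of_out u v (not_in_of_mem_sdiff hi)]
  · refine Finset.sum_congr rfl fun k _ => ?_
    rw [Finset.sum_congr rfl fun i hi => by rw [zset_of_in h u v (mem_zblk.mp hi).1 (mem_zblk.mp hi).2], Finset.sum_const, hm k,
      smul_eq_mul]

/-- **prefix weight on a masked piece**: `wtPrefix (zset u v) g = zoffP u g + Σ_k [v k]·zmcut k g`. -/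
theorem wtPrefix_zset (h : ((∀ k k', k < k' → s k + ℓ ≤ s k') ∧ (∀ k, s k + ℓ ≤ n))) (u : Fin n → Bool) (v : Fin N → Bool) (g : ℕ) :
    wtPrefix (zset ℓ s Z u v) g = zoffP ℓ s Z u g + ∑ k : Fin N, (if v k = true then zmcut ℓ s Z k g else 0) := by
  unfold wtPrefix zoffP
  rw [Finset.card_filter, sum_split_z h, Finset.card_filter]
  congr 1
  · refine Finset.sum_congr rfl fun i hi => ?_
    rw [zset_of_out u v (not_in_of_mem_sdiff hi)]
  · refine Finset.sum_congr rfl fun k _ => ?_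
    rw [Finset.sum_congr rfl fun i hi => by rw [zset_of_in h u v (mem_zblk.mp hi).1 (mem_zblk.mp hi).2]]
    unfold zmcut
    rw [Finset.card_filter]
    cases v k <;> simp

/-- a masked block entirely before the cut counts fully. -/
theorem zmcut_of_before (hm : ∀ k, (zblk ℓ s Z k).card = m) {k : Fin N} {g : ℕ} (hk : s k + ℓ ≤ g) : zmcut ℓ s Z k g = m := by
  unfold zmcut
  rw [Finset.filter_true_of_mem fun i hi => ?_, hm k]
  have := (mem_zblk.mp hi).1.2
  omega

/-- a masked block entirely after the cut counts nothing. -/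
theorem zmcut_of_after {k : Fin N} {g : ℕ} (hk : g ≤ s k) : zmcut ℓ s Z k g = 0 := by
  unfold zmcut
  rw [Finset.card_eq_zero, Finset.filter_eq_empty_iff]
  intro i hi
  have := (mem_zblk.mp hi).1.1
  omega

/-- the masked straddle count `Σ_{k ∈ strad g} zmcut k g`. -/
def zmstr (ℓ : ℕ) (s : Fin N → ℕ) (Z : Finset (Fin n)) (g : ℕ) : ℕ := ∑ k ∈ strad ℓ s g, zmcut ℓ s Z k g

/-- the straddle part of the prefix weight is the straddle bit times the masked straddle count. -/
theorem sum_strad_eq_z (h : ((∀ k k', k < k' → s k + ℓ ≤ s k') ∧ (∀ k, s k + ℓ ≤ n))) (g : ℕ) (v : Fin N → Bool) :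
    (∑ k ∈ strad ℓ s g, (if v k = true then zmcut ℓ s Z k g else 0))
      = if sel ℓ s g v = true then zmstr ℓ s Z g else 0 := by
  rcases (strad ℓ s g).eq_empty_or_nonempty with he | ⟨k₀, hk₀⟩
  · simp [he, sel]
  · have hS : strad ℓ s g = {k₀} :=
      Finset.eq_singleton_iff_unique_mem.mpr ⟨hk₀, fun k hk => Finset.card_le_one.mp (card_strad_le_one h g) k hk k₀ hk₀⟩
    have hsel : sel ℓ s g v = v k₀ := by
      unfold sel
      rw [hS]
      cases hv : v k₀ <;> simp [hv]
    rw [hsel, zmstr, hS, Finset.sum_singleton, Finset.sum_singleton]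

/-- **the walk exponent on a masked piece**: off-mask constant + `m ×` the standard walk exponent of `v` at block position `qcut g`
+ the straddle correction. -/
theorem walkExp_zset (h : ((∀ k k', k < k' → s k + ℓ ≤ s k') ∧ (∀ k, s k + ℓ ≤ n))) (hm : ∀ k, (zblk ℓ s Z k).card = m)
    (u : Fin n → Bool) (v : Fin N → Bool) (g : ℕ) :
    walkExp (zset ℓ s Z u v) g
      = zoffW ℓ s Z u + zoffP ℓ s Z u g + m * walkExp v (qcut ℓ s g) + (if sel ℓ s g v = true then zmstr ℓ s Z g else 0) := by
  unfold walkExp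
  rw [wt_zset h hm, wtPrefix_zset h]
  have hsplit : ∀ k : Fin N, (if v k = true then zmcut ℓ s Z k g else 0)
      = (if s k + ℓ ≤ g then (if v k = true then m else 0) else 0)
        + (if k ∈ strad ℓ s g then (if v k = true then zmcut ℓ s Z k g else 0) else 0) := by
    intro k
    by_cases hb : s k + ℓ ≤ g
    · have hns : k ∉ strad ℓ s g := by
        rw [strad, mem_filter]
        exact fun hh => by omega
      rw [if_pos hb, if_neg hns, zmcut_of_before hm hb]; simp
    · rw [if_neg hb]
      by_cases hst : k ∈ strad ℓ s g
      · rw [if_pos hst]; simp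
      · rw [if_neg hst]
        have hga : g ≤ s k := by
          by_contra hlt
          exact hst (by rw [strad, mem_filter]; exact ⟨mem_univ _, by omega, by omega⟩)
        rw [zmcut_of_after hga]; simp
  rw [Finset.sum_congr rfl fun k _ => hsplit k, Finset.sum_add_distrib]
  have hstr : (∑ k : Fin N, (if k ∈ strad ℓ s g then (if v k = true then zmcut ℓ s Z k g else 0) else 0))
      = if sel ℓ s g v = true then zmstr ℓ s Z g else 0 := by
    rw [Finset.sum_ite_mem, Finset.univ_inter]
    exact sum_strad_eq_z h g v
  have hbefore : (∑ k : Fin N, (if s k + ℓ ≤ g then (if v k = true then m else 0) else 0))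
      = m * wtPrefix v (qcut ℓ s g) := by
    unfold wtPrefix
    rw [Finset.card_filter, Finset.mul_sum]
    refine Finset.sum_congr rfl fun k _ => ?_
    by_cases hb : s k + ℓ ≤ g
    · have hk : k.val < qcut ℓ s g := (before_iff h g k).mp hb
      cases v k <;> simp [hb, hk]
    · have hk : ¬ k.val < qcut ℓ s g := fun hh => hb ((before_iff h g k).mpr hh)
      cases v k <;> simp [hb, hk]
  have hwt : m * wt v = ∑ k : Fin N, (if v k = true then m else 0) := by
    unfold wt
    rw [Finset.card_filter, Finset.mul_sum]
    refine Finset.sum_congr rfl fun k _ => ?_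
    cases v k <;> simp
  rw [hstr, hbefore, Nat.mul_add, hwt]
  ring

/-! #### liveness on a masked piece -/

/-- the PHASE of the bell `(g, ε)` of the masked piece game. -/
def zkap (ℓ m : ℕ) (s : Fin N → ℕ) (Z : Finset (Fin n)) (c : ℕ) (u : Fin n → Bool) (g : ℕ) (ε : Bool) : ℕ :=
  rfac m * (c + g + zoffW ℓ s Z u + zoffP ℓ s Z u g + (if ε = true then zmstr ℓ s Z g else 0))

/-- **liveness on a masked piece is liveness of a standard bell in block coordinates** (`m ≢ 0 (mod 3)`). -/
theorem live_iff_z (h : ((∀ k k', k < k' → s k + ℓ ≤ s k') ∧ (∀ k, s k + ℓ ≤ n))) (hm : ∀ k, (zblk ℓ s Z k).card = m)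
    (hm3 : m % 3 = 1 ∨ m % 3 = 2) (c : ℕ) (u : Fin n → Bool) (v : Fin N → Bool) (g : ℕ) :
    ((c + g + walkExp (zset ℓ s Z u v) g) % 3 ≠ 0)
      ↔ ((zkap ℓ m s Z c u g (sel ℓ s g v) + walkExp v (qcut ℓ s g)) % 3 ≠ 0) := by
  rw [walkExp_zset h hm]
  have e : c + g + (zoffW ℓ s Z u + zoffP ℓ s Z u g + m * walkExp v (qcut ℓ s g)
      + (if sel ℓ s g v = true then zmstr ℓ s Z g else 0))
      = (c + g + zoffW ℓ s Z u + zoffP ℓ s Z u g + (if sel ℓ s g v = true then zmstr ℓ s Z g else 0))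
        + m * walkExp v (qcut ℓ s g) := by ring
  rw [e]
  rcases hm3 with h1 | h2
  · rw [mod3_of_one h1, zkap, rfac, if_pos h1, one_mul]
  · have hne : ¬ m % 3 = 1 := by omega
    rw [mod3_of_two h2, zkap, rfac, if_neg hne]

/-! #### forms with ZERO SUM on every masked block are frozen along the piece -/

/-- a coefficient vector with zero sum on the masked block `k` contributes `0` over it at every piece point. -/
theorem sum_zblk_zset_eq_zero_of_null (h : ((∀ k k', k < k' → s k + ℓ ≤ s k') ∧ (∀ k, s k + ℓ ≤ n))) (a : Fin n → ZMod p) {k : Fin N}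
    (hnull : ∑ i ∈ zblk ℓ s Z k, a i = 0) (u : Fin n → Bool) (w : Fin N → Bool) :
    (∑ i ∈ zblk ℓ s Z k, (if zset ℓ s Z u w i = true then a i else 0)) = 0 := by
  rw [Finset.sum_congr rfl fun i hi => by rw [zset_of_in h u w (mem_zblk.mp hi).1 (mem_zblk.mp hi).2]]
  cases hw : w k
  · simp
  · simpa using hnull

/-- **the form of a cut whose coefficient vector is zero-sum on every masked block is CONSTANT along the piece.** -/
theorem form_zset_null (h : ((∀ k k', k < k' → s k + ℓ ≤ s k') ∧ (∀ k, s k + ℓ ≤ n))) (D : JLinPeel.JLinData p n) (g : Fin (n + 1))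
    (hnull : ∀ k : Fin N, ∑ i ∈ zblk ℓ s Z k, D.a g i = 0) (u : Fin n → Bool) (v v' : Fin N → Bool) :
    D.form g (zset ℓ s Z u v) = D.form g (zset ℓ s Z u v') := by
  unfold JLinPeel.JLinData.form
  have split := fun w : Fin N → Bool => sum_split_z (Z := Z) h (fun i => if zset ℓ s Z u w i = true then D.a g i else 0)
  rw [split v, split v']
  congr 1
  · refine Finset.sum_congr rfl fun i hi => ?_
    rw [zset_of_out u v (not_in_of_mem_sdiff hi), zset_of_out u v' (not_in_of_mem_sdiff hi)]
  · refine Finset.sum_congr rfl fun k _ => ?_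
    rw [sum_zblk_zset_eq_zero_of_null h (D.a g) (hnull k) u v, sum_zblk_zset_eq_zero_of_null h (D.a g) (hnull k) u v']

/-- along the piece a zero-sum cut's answer depends on `v` only through the span windows meeting its junta. -/
theorem strat_zset_eq_null (h : ((∀ k k', k < k' → s k + ℓ ≤ s k') ∧ (∀ k, s k + ℓ ≤ n))) (D : JLinPeel.JLinData p n) (g : Fin (n + 1))
    (hnull : ∀ k : Fin N, ∑ i ∈ zblk ℓ s Z k, D.a g i = 0) (u : Fin n → Bool) {v v' : Fin N → Bool}
    (hvv : ∀ k : Fin N, (∃ i ∈ D.J g, (s k ≤ i.val ∧ i.val < s k + ℓ)) → v k = v' k) :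
    D.strat g (zset ℓ s Z u v) = D.strat g (zset ℓ s Z u v') := by
  have hJ : ∀ i ∈ D.J g, zset ℓ s Z u v i = zset ℓ s Z u v' i := by
    intro i hi
    by_cases hk : (∃ k, (s k ≤ i.val ∧ i.val < s k + ℓ)) ∧ i ∈ Z
    · obtain ⟨⟨k, hk⟩, hZ⟩ := hk
      rw [zset_of_in h u v hk hZ, zset_of_in h u v' hk hZ, hvv k ⟨i, hi, hk⟩]
    · have hk' : ∀ k, ¬ ((s k ≤ i.val ∧ i.val < s k + ℓ) ∧ i ∈ Z) := fun k hh => hk ⟨⟨k, hh.1⟩, hh.2⟩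
      rw [zset_of_out u v hk', zset_of_out u v' hk']
  show D.h g (zset ℓ s Z u v) (D.form g (zset ℓ s Z u v)) = D.h g (zset ℓ s Z u v') (D.form g (zset ℓ s Z u v'))
  rw [form_zset_null h D g hnull u v v', D.hJ g _ _ hJ]

/-- **degree of a masked-piece bell**: junta `≤ L` ⇒ the bell `(g, ε)` has degree `≤ L + 1` in the block bits. -/
theorem hasDeg_bell_z (h : ((∀ k k', k < k' → s k + ℓ ≤ s k') ∧ (∀ k, s k + ℓ ≤ n))) (D : JLinPeel.JLinData p n) (g : Fin (n + 1)) (ε : Bool)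
    {L d : ℕ} (hJ : (D.J g).card ≤ L) (hd : L + 1 ≤ d) (hnull : ∀ k : Fin N, ∑ i ∈ zblk ℓ s Z k, D.a g i = 0) (u : Fin n → Bool) :
    HasDeg (fun v : Fin N → Bool => D.strat g (zset ℓ s Z u v) && (ε == sel ℓ s g.val v)) d := by
  classical
  refine hasDeg_of_dependsOn_blk ((univ.filter fun k : Fin N => ∃ i ∈ D.J g, (s k ≤ i.val ∧ i.val < s k + ℓ)) ∪ strad ℓ s g.val) ?_
    fun v v' hvv => ?_
  · calc ((univ.filter fun k : Fin N => ∃ i ∈ D.J g, (s k ≤ i.val ∧ i.val < s k + ℓ)) ∪ strad ℓ s g.val).card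
        ≤ (univ.filter fun k : Fin N => ∃ i ∈ D.J g, (s k ≤ i.val ∧ i.val < s k + ℓ)).card + (strad ℓ s g.val).card :=
          Finset.card_union_le _ _
      _ ≤ L + 1 := add_le_add (le_trans (card_blkMeet_le h (D.J g)) hJ) (card_strad_le_one h g.val)
      _ ≤ d := hd
  · have h1 : D.strat g (zset ℓ s Z u v) = D.strat g (zset ℓ s Z u v') :=
      strat_zset_eq_null h D g hnull u fun k hk => hvv k (Finset.mem_union_left _ (mem_filter.mpr ⟨mem_univ _, hk⟩))
    have h2 : sel ℓ s g.val v = sel ℓ s g.val v' := sel_congr g.val fun k hk => hvv k (Finset.mem_union_right _ hk)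
    rw [h1, h2]

/-! #### the masked piece game is a generalised-bell walk game, for ANY strategy -/

/-- **the game identity**: the walk game at the piece point `zset u v` is the generalised-bell game on `v` with two straddle-conditioned bells per
cut (pattern position `qcut g`, phases `zkap … ff / tt`). -/
theorem ringWinU_zset_gen (h : ((∀ k k', k < k' → s k + ℓ ≤ s k') ∧ (∀ k, s k + ℓ ≤ n))) (hm : ∀ k, (zblk ℓ s Z k).card = m)
    (hm3 : m % 3 = 1 ∨ m % 3 = 2) (c : ℕ) (σ : Fin (n + 1) → (Fin n → Bool) → Bool) (u : Fin n → Bool) (v : Fin N → Bool) :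
    ringWinU c σ (zset ℓ s Z u v)
      = AffBells23.ringWinGen (fun b => qcut ℓ s (bellEquiv n b).1.val) (fun b => zkap ℓ m s Z c u (bellEquiv n b).1.val (bellEquiv n b).2)
          (fun b w => σ (bellEquiv n b).1 (zset ℓ s Z u w) && ((bellEquiv n b).2 == sel ℓ s (bellEquiv n b).1.val w)) v := by
  unfold ringWinU AffBells23.ringWinGen
  congr 3
  symm
  rw [Finset.card_equiv (bellEquiv n) (t := univ.filter fun x : Fin (n + 1) × Bool =>
      (σ x.1 (zset ℓ s Z u v) && (x.2 == sel ℓ s x.1.val v)) = true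
        ∧ (zkap ℓ m s Z c u x.1.val x.2 + walkExp v (qcut ℓ s x.1.val)) % 3 ≠ 0) (fun b => by simp)]
  symm
  refine Finset.card_bij (fun (g : Fin (n + 1)) _ => (g, sel ℓ s g.val v)) (fun g hg => ?_) (fun g₁ _ g₂ _ hh => ?_) (fun x hx => ?_)
  · rw [mem_filter] at hg ⊢
    refine ⟨mem_univ _, by simpa using hg.2.1, ?_⟩
    exact (live_iff_z h hm hm3 c u v g.val).mp hg.2.2
  · exact (Prod.ext_iff.mp hh).1
  · rw [mem_filter] at hx
    obtain ⟨_, h1, h2⟩ := hx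
    rw [Bool.and_eq_true] at h1
    have hε : x.2 = sel ℓ s x.1.val v := by simpa using h1.2
    refine ⟨x.1, ?_, ?_⟩
    · rw [mem_filter]
      refine ⟨mem_univ _, h1.1, ?_⟩
      rw [hε] at h2
      exact (live_iff_z h hm hm3 c u v x.1.val).mpr h2
    · ext <;> simp [hε]

/-- ★ **THE MASK-PIECE ENGINE.**  There are `θ < 1` and `N₀` — uniform in the span length `ℓ`, the mask size `m` and the modulus `p` — such that along
EVERY piece of `N ≥ N₀` separated spans with masked blocks of a common size `m ≢ 0 (mod 3)` on which every cut's coefficient vector mod `p` is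
ZERO-SUM, a junta-`≤ L` ⊕ linear-form strategy with `(L+1)² ≤ N` wins on at most `θ·2^N` of the `2^N` piece points. -/
theorem maskPiece_hard :
    ∃ θ : ℝ, θ < 1 ∧ ∃ N₀ : ℕ, ∀ (ℓ m : ℕ), (m % 3 = 1 ∨ m % 3 = 2) → ∀ (p n N : ℕ) (s : Fin N → ℕ) (Z : Finset (Fin n)),
      ((∀ k k', k < k' → s k + ℓ ≤ s k') ∧ (∀ k, s k + ℓ ≤ n)) → (∀ k, (zblk ℓ s Z k).card = m) → N₀ ≤ N →
      ∀ (L : ℕ), (L + 1) * (L + 1) ≤ N → ∀ (c : ℕ) (D : JLinPeel.JLinData p n),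
        (∀ g, (D.J g).card ≤ L) → (∀ g (k : Fin N), ∑ i ∈ zblk ℓ s Z k, D.a g i = 0) →
        ∀ u : Fin n → Bool,
          ((univ.filter fun v : Fin N → Bool => ringWinU c D.strat (zset ℓ s Z u v) = true).card : ℝ) ≤ θ * (2 : ℝ) ^ N := by
  obtain ⟨θ, hθ, n₀, hgen⟩ := AffBells23.walkHardGenSqrt
  refine ⟨θ, hθ, n₀, fun ℓ m hm3 p n N s Z hs hm hN L hL c D hJ hnull u => ?_⟩
  have hdeg : ∀ b : Fin ((n + 1) * 2), HasDeg (fun w : Fin N → Bool =>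
      D.strat (bellEquiv n b).1 (zset ℓ s Z u w) && ((bellEquiv n b).2 == sel ℓ s (bellEquiv n b).1.val w)) (Nat.sqrt N) :=
    fun b => hasDeg_bell_z hs D _ _ (hJ _) (Nat.le_sqrt.mpr hL) (hnull _) u
  have hb := hgen N hN ((n + 1) * 2) (fun b => qcut ℓ s (bellEquiv n b).1.val)
    (fun b => zkap ℓ m s Z c u (bellEquiv n b).1.val (bellEquiv n b).2) _ hdeg
  have hset : (univ.filter fun v : Fin N → Bool => ringWinU c D.strat (zset ℓ s Z u v) = true)
      = univ.filter fun v : Fin N → Bool => AffBells23.ringWinGen (fun b => qcut ℓ s (bellEquiv n b).1.val)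
          (fun b => zkap ℓ m s Z c u (bellEquiv n b).1.val (bellEquiv n b).2)
          (fun b w => D.strat (bellEquiv n b).1 (zset ℓ s Z u w) && ((bellEquiv n b).2 == sel ℓ s (bellEquiv n b).1.val w)) v
          = true := by
    refine Finset.filter_congr fun v _ => ?_
    rw [ringWinU_zset_gen hs hm hm3 c D.strat u v]
  rw [hset]
  exact hb

end MaskPiece

end Summit.QuantumAdvantage.AdviceFreeQNC0.JLinPeel.MaskDial
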